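import Summits.HubbardSuperconductivity.HubbardSuperconductivity.Theorems.JosephsonMirrorGibbsMarkovSelection
import Summits.HubbardSuperconductivity.HubbardSuperconductivity.Theorems.JosephsonMirrorJmCuspGainCap
import Summits.HubbardSuperconductivity.HubbardSuperconductivity.Theorems.LogColdTorusAverageToEveryStubBlockAverageWitness
import HarnessLib

/-!
# Route `JosephsonMirror` — crux `JmCusp` (stmt-HubbardSuperconductivity-2228), line `cocountable-coupling-selection`:
# stub `stub_logColdGivesWindowOrder` — log-cold sector Gibbs `d`-wave order gives window zero-excess pair order

Registered stub of the line `cocountable-coupling-selection` (skeleton `Cruxes/JmCusp/Lines/cocountable_coupling_selection.lean`):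
the statement of the EXISTING open item stmt-HubbardSuperconductivity-8807 (`LogColdTorus.LogColdDWaveOrder`: `d`-wave pair
order `c L⁴ ≤ Re ω_{κ log L}(Δ_dᴴ Δ_d)` of the Gibbs state of `hubbardTorus 2 L 1 U` COMPRESSED to the `(N_L, S^z = 0)`
coordinate sector at inverse temperature `β = κ log L`, uniformly on a coupling window, for every `κ ≥ κ₀`; its
`let p := …` ζ-reduced) implies `stub_orderedWindow` (zero-excess `d`-wave pair order at EVERY coupling of the same window
at the same doping, the right-hand side of `josephsonGain_iff_zeroExcessPairOrder` verbatim), with constant `c/2` and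
`n = N_L`.

Proof (Koma–Tasaki's "order at vanishing excess energy", finite volume): fix `κ = κ₀`.  On the sector block `V`
(`card V ≤ 4^{L²}`) the Gibbs state at `β = κ₀ log L` is, in an eigenbasis of the block Hamiltonian `K`, the probability
vector `e^{-βλᵢ}/Z`; the energy–entropy bound `Σ wᵢ λᵢ ≤ λ_min + log(card V)/β` and Markov
(`exists_eigenvector_of_gibbsState_le`, file `Theorems/JosephsonMirrorGibbsMarkovSelection`) produce an EIGENVECTOR of the
block with eigenvalue `≤ λ_min + 64ℓ/c + 1`, `ℓ = log(card V)/β ≤ 2L² log 2/(κ₀ log L) = o(L²)`, whose `d`-wave pair amplitude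
is still `≥ cL⁴ − 32L⁴·ℓ/(64ℓ/c + 1) ≥ (c/2)L⁴` (`‖Δ_d‖² ≤ 32L⁴`, `norm_pairField_dWave_sq_le`).  Extended by zero it is a
unit vector of `szSector N_L 0`, an eigenvector of `hubbardTorus 2 L 1 U` (the sector is invariant), with energy within
`64ℓ/c + 1 ≤ εL²` of the sector floor once `log L ≥ 256 log 2/(c κ₀ ε)` and `L ≥ 2/ε`.

Sources: T. Koma, H. Tasaki, J. Stat. Phys. 76 (1994) 745, §2; H. Tasaki, *Physics and Mathematics of Quantum Many-Body
Systems* (2020), App. A.  No new definitions.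
-/

noncomputable section

-- the mandated namespace `Summit.<Summit>.<Problem>.Theorems` repeats `HubbardSuperconductivity`
-- (single-problem summit, D-0017), which the `dupNamespace` linter flags on every declaration
set_option linter.dupNamespace false

namespace Summit.HubbardSuperconductivity.HubbardSuperconductivity.Theorems.JosephsonMirror

open Matrix Literature.MathematicalPhysics.QuantumLattice
open scoped ComplexOrder Classical

/-- **stmt-8807 ⇒ `stub_orderedWindow`** (registered stub `stub_logColdGivesWindowOrder` of line
`cocountable-coupling-selection`; see the file docstring for the statement and the proof).  Koma–Tasaki (1994) §2;
Tasaki (2020) App. A. [folklore] -/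
theorem stub_logColdGivesWindowOrder :
    (∃ δ ∈ Set.Ioo (0:ℝ) (1/2), ∃ U₁ U₂ : ℝ, 0 < U₁ ∧ U₁ < U₂ ∧ ∃ κ₀ c : ℝ, 0 < κ₀ ∧ 0 < c ∧ ∀ κ : ℝ, κ₀ ≤ κ → ∃ L₀ : ℕ, ∀ U ∈ Set.Ioo U₁ U₂, ∀ (L : ℕ) [NeZero L], L₀ ≤ L → Even L → c * (L : ℝ) ^ 4 ≤ (Matrix.gibbsState (κ * Real.log L) ((Literature.MathematicalPhysics.QuantumLattice.hubbardTorus 2 L 1 U).toBlock (fun s : Finset (Literature.MathematicalPhysics.QuantumLattice.Orb (Literature.MathematicalPhysics.QuantumLattice.FermionTorus 2 L)) => s.card = 2 * ⌊(1 - δ) * (L : ℝ) ^ 2 / 2⌋₊ ∧ 2 * (s.filter fun i => (ofLex i).2 = 0).card = 2 * ⌊(1 - δ) * (L : ℝ) ^ 2 / 2⌋₊) (fun s : Finset (Literature.MathematicalPhysics.QuantumLattice.Orb (Literature.MathematicalPhysics.QuantumLattice.FermionTorus 2 L)) => s.card = 2 * ⌊(1 - δ) * (L : ℝ) ^ 2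 / 2⌋₊ ∧ 2 * (s.filter fun i => (ofLex i).2 = 0).card = 2 * ⌊(1 - δ) * (L : ℝ) ^ 2 / 2⌋₊)) (((Literature.MathematicalPhysics.QuantumLattice.pairField Literature.MathematicalPhysics.QuantumLattice.dWaveFormFactor L)ᴴ * Literature.MathematicalPhysics.QuantumLattice.pairField Literature.MathematicalPhysics.QuantumLattice.dWaveFormFactor L).toBlock (fun s : Finset (Literature.MathematicalPhysics.QuantumLattice.Orb (Literature.MathematicalPhysics.QuantumLattice.FermionTorus 2 L)) => s.card = 2 * ⌊(1 - δ) * (L : ℝ) ^ 2 / 2⌋₊ ∧ 2 * (s.filter fun i => (ofLex i).2 = 0).card = 2 * ⌊(1 - δ) * (L : ℝ) ^ 2 / 2⌋₊) (fun s : Finset (Literature.MathematicalPhysics.QuantumLattice.Orb (Literature.MathematicalPhysics.QuantumLattice.FermionTorus 2 L)) => s.card = 2 * ⌊(1 - δ) * (L : ℝ) ^ 2 / 2⌋₊ ∧ 2 * (s.filter fun i => (ofLex i).2 = 0).card = 2 * ⌊(1 - δ) * (L : ℝ) ^ 2 / 2⌋₊))).re) →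
    ∃ δ ∈ Set.Ioo (0:ℝ) (1 / 2), ∃ a b : ℝ, 0 < a ∧ a < b ∧ ∀ U ∈ Set.Ioo a b,
      ∃ c : ℝ, 0 < c ∧ ∀ ε : ℝ, 0 < ε → ∃ L₀ : ℕ, ∀ (L : ℕ) [NeZero L], Even L → L₀ ≤ L → ∃ n : ℕ, (n = 2 * ⌊(1 - δ) * (L : ℝ) ^ 2 / 2⌋₊ ∨ n = 2 * ⌊(1 - δ) * (L : ℝ) ^ 2 / 2⌋₊ - 2) ∧ ∃ v : Literature.MathematicalPhysics.QuantumLattice.Fock (Literature.MathematicalPhysics.QuantumLattice.Orb (Literature.MathematicalPhysics.QuantumLattice.FermionTorus 2 L)), v ∈ Literature.MathematicalPhysics.QuantumLattice.szSector n 0 ∧ star v ⬝ᵥ v = 1 ∧ (star v ⬝ᵥ (Literature.MathematicalPhysics.QuantumLattice.hubbardTorus 2 L 1 U *ᵥ v)).re ≤ (Literature.MathematicalPhysics.QuantumLattice.hubbardTorus 2 L 1 U).minEnergyOn (Literature.MathematicalPhysics.QuantumLattice.szSector n 0) + ε * (L : ℝ) ^ 2 ∧ c * (L : ℝ) ^ 4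 ≤ (star (Literature.MathematicalPhysics.QuantumLattice.pairField Literature.MathematicalPhysics.QuantumLattice.dWaveFormFactor L *ᵥ v) ⬝ᵥ (Literature.MathematicalPhysics.QuantumLattice.pairField Literature.MathematicalPhysics.QuantumLattice.dWaveFormFactor L *ᵥ v)).re := by
  classical
  rintro ⟨δ, hδ, U₁, U₂, hU₁, hU₁₂, κ₀, c, hκ₀, hc, hκ⟩
  obtain ⟨L₀', h8⟩ := hκ κ₀ le_rfl
  refine ⟨δ, hδ, U₁, U₂, hU₁, hU₁₂, fun U hU => ⟨c / 2, by positivity, fun ε hε => ?_⟩⟩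
  -- thresholds: `L ≥ L₀'`, `L ≥ 2`, `log L ≥ R`, `L ≥ 2/ε`
  set R : ℝ := 256 * Real.log 2 / (c * κ₀ * ε) with hR
  refine ⟨max (max L₀' 2) (max ⌈Real.exp R⌉₊ ⌈2 / ε⌉₊), ?_⟩
  intro L _ hE hL
  have hL₀' : L₀' ≤ L := le_trans (le_max_left _ _) (le_trans (le_max_left _ _) hL)
  have hL2 : 2 ≤ L := le_trans (le_max_right _ _) (le_trans (le_max_left _ _) hL)
  have hLexp : Real.exp R ≤ (L : ℝ) :=
    le_trans (Nat.le_ceil _) (by exact_mod_cast le_trans (le_max_left _ _) (le_trans (le_max_right _ _) hL))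
  have hLε : 2 / ε ≤ (L : ℝ) :=
    le_trans (Nat.le_ceil _) (by exact_mod_cast le_trans (le_max_right _ _) (le_trans (le_max_right _ _) hL))
  have hL2r : (2 : ℝ) ≤ L := by exact_mod_cast hL2
  have hL1r : (1 : ℝ) ≤ L := by linarith
  have hlogL : 0 < Real.log L := Real.log_pos (by linarith)
  have hlogR : R ≤ Real.log L := by
    have := Real.log_le_log (Real.exp_pos R) hLexp
    rwa [Real.log_exp] at this
  -- the objects
  set n : ℕ := ⌊(1 - δ) * (L : ℝ) ^ 2 / 2⌋₊ with hn
  set N : ℕ := 2 * n with hN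
  set pr : Finset (Orb (FermionTorus 2 L)) → Prop := fun s =>
    s.card = 2 * ⌊(1 - δ) * (L : ℝ) ^ 2 / 2⌋₊ ∧
      2 * (s.filter fun i => (ofLex i).2 = 0).card = 2 * ⌊(1 - δ) * (L : ℝ) ^ 2 / 2⌋₊ with hpr
  set H : Matrix (Finset (Orb (FermionTorus 2 L))) (Finset (Orb (FermionTorus 2 L))) ℂ := hubbardTorus 2 L 1 U
    with hHdef
  set Δ : Matrix (Finset (Orb (FermionTorus 2 L))) (Finset (Orb (FermionTorus 2 L))) ℂ :=
    pairField dWaveFormFactor L with hΔdef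
  set K := H.toBlock pr pr with hKdef
  set O := (Δᴴ * Δ).toBlock pr pr with hOdef
  set β : ℝ := κ₀ * Real.log L with hβdef
  have hβ : 0 < β := mul_pos hκ₀ hlogL
  -- the hypothesis at `L`
  have h8L : c * (L : ℝ) ^ 4 ≤ (gibbsState β K O).re := h8 U hU L hL₀' hE
  -- the sector predicate is Lieb's
  have hpr_iff : ∀ s, pr s ↔ ((upPart s).card = n ∧ (downPart s).card = n) := fun s =>
    Summit.HubbardSuperconductivity.HubbardSuperconductivity.Theorems.card_block_iff_upPart_downPart n s
  -- Hermiticity, invariance of the sector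
  have hHherm : H.IsHermitian := LiebThm1.hamiltonian_isHermitian (fermionTorusGraph 2 L) 1 U
  have hKherm : K.IsHermitian := hHherm.submatrix _
  have hinv : ∀ i j, ¬ pr i → pr j → H i j = 0 := by
    intro i j hi hj
    by_contra h
    have hsec := LiebThm1.preservesSectors_hamiltonian (fermionTorusGraph 2 L) 1 U i j h
    rw [hpr_iff] at hi hj
    exact hi ⟨hsec.1.trans hj.1, hsec.2.trans hj.2⟩
  -- the block is nonempty: a sector ground state has a nonzero coordinate in the sector
  have hnL : n ≤ L ^ 2 := by
    rw [hn]
    refine Nat.floor_le_of_le ?_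
    have hδ0 : 1 - δ ≤ 1 := by linarith [hδ.1]
    have hL0 : (0 : ℝ) ≤ (L : ℝ) ^ 2 := by positivity
    push_cast
    nlinarith
  have hcard : n ≤ Fintype.card (FermionTorus 2 L) := by rwa [card_fermionTorus]
  obtain ⟨⟨ψ, hψmem, hψ0, -⟩, -⟩ := szSector_groundState (fermionTorusGraph 2 L) 1 U hcard
  have hψsec : IsInSector n n ψ := (mem_szSector_two_mul_zero_iff n ψ).1 hψmem
  obtain ⟨s₀, hs₀⟩ := Function.ne_iff.1 hψ0
  have hpr₀ : pr s₀ := by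
    rw [hpr_iff]
    by_contra h
    exact hs₀ (hψsec s₀ h)
  haveI : Nonempty {s // pr s} := ⟨⟨s₀, hpr₀⟩⟩
  -- the observable on unit block vectors: `0 ≤ Re ⟨u, O u⟩ ≤ 32 L⁴`
  have hOform : ∀ u : {s // pr s} → ℂ, (star u ⬝ᵥ O *ᵥ u).re =
      (star (Δ *ᵥ fun i => if h : pr i then u ⟨i, h⟩ else 0) ⬝ᵥ
        (Δ *ᵥ fun i => if h : pr i then u ⟨i, h⟩ else 0)).re := by
    intro u
    rw [hOdef, star_dotProduct_toBlock_mulVec, star_mulVec, ← dotProduct_mulVec, mulVec_mulVec]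
  have hunit : ∀ u : {s // pr s} → ℂ, star u ⬝ᵥ u = 1 →
      star (fun i => if h : pr i then u ⟨i, h⟩ else 0) ⬝ᵥ (fun i => if h : pr i then u ⟨i, h⟩ else 0) = 1 := by
    intro u hu
    rw [star_blockExt_dotProduct]
    have : (fun a : {s // pr s} => (fun i => if h : pr i then u ⟨i, h⟩ else 0) a.1) = u := by
      funext a
      simp [a.2]
    rw [this, hu]
  have hO0 : ∀ u : {s // pr s} → ℂ, star u ⬝ᵥ u = 1 → 0 ≤ (star u ⬝ᵥ O *ᵥ u).re := by
    intro u _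
    rw [hOform]
    exact (Complex.nonneg_iff.mp (dotProduct_star_self_nonneg _)).1
  have hOM : ∀ u : {s // pr s} → ℂ, star u ⬝ᵥ u = 1 → (star u ⬝ᵥ O *ᵥ u).re ≤ 32 * (L : ℝ) ^ 4 := by
    intro u hu
    rw [hOdef, star_dotProduct_toBlock_mulVec]
    refine (re_star_dotProduct_conjTranspose_mul_mulVec_le Δ _).trans ?_
    rw [hunit u hu, Complex.one_re, mul_one, hΔdef]
    exact norm_pairField_dWave_sq_le L
  -- Markov selection of an eigenvector of the block
  set ℓ : ℝ := Real.log (Fintype.card {s // pr s}) / β with hℓ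
  have hℓ0 : 0 ≤ ℓ := div_nonneg (Real.log_natCast_nonneg _) hβ.le
  set t : ℝ := 64 * ℓ / c + 1 with ht
  have ht0 : 0 < t := by positivity
  obtain ⟨i, hlow, hobs⟩ := exists_eigenvector_of_gibbsState_le hKherm O hO0 hOM hβ ht0 h8L
  set u : {s // pr s} → ℂ := fun a => (hKherm.eigenvectorUnitary : Matrix _ _ ℂ) a i with hu
  set v : Fock (Orb (FermionTorus 2 L)) := fun j => if h : pr j then u ⟨j, h⟩ else 0 with hv
  have hu1 : star u ⬝ᵥ u = 1 := star_eigencol_dotProduct_self hKherm i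
  have hv1 : star v ⬝ᵥ v = 1 := hunit u hu1
  have hKu : K *ᵥ u = ((hKherm.eigenvalues i : ℝ) : ℂ) • u := mulVec_eigencol hKherm i
  -- `v` is a unit eigenvector of `H` in the sector
  have hvmem : v ∈ szSector N 0 := by
    rw [hN, mem_szSector_two_mul_zero_iff]
    intro s hs
    rw [← hpr_iff] at hs
    simp [hv, hs]
  have hHv : H *ᵥ v = ((hKherm.eigenvalues i : ℝ) : ℂ) • v := by
    rw [hv, mulVec_blockExt_of_offBlock_eq_zero pr H hinv u, hKu]
    funext j
    by_cases hj : pr j <;> simp [hj]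
  have hvE : (star v ⬝ᵥ (H *ᵥ v)).re = hKherm.eigenvalues i := by
    rw [hHv, dotProduct_smul, hv1, smul_eq_mul, mul_one, Complex.ofReal_re]
  -- the sector floor is at least the bottom of the block spectrum: `λⱼ₀ ≤ e`
  obtain ⟨j₀, hj₀⟩ := exists_eq_ciInf_of_finite (f := hKherm.eigenvalues)
  have hfloor : hKherm.eigenvalues j₀ ≤ H.minEnergyOn (szSector N 0) := by
    refine le_csInf ⟨_, v, hvmem, hv1, rfl⟩ ?_
    rintro E ⟨φ, hφmem, hφ1, rfl⟩
    -- `φ` is supported in the sector: restrict it to the block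
    have hφsec : IsInSector n n φ := (mem_szSector_two_mul_zero_iff n φ).1 (hN ▸ hφmem)
    set w : {s // pr s} → ℂ := fun a => φ a.1 with hw
    have hφext : (fun j => if h : pr j then w ⟨j, h⟩ else 0) = φ := by
      funext j
      by_cases hj : pr j
      · simp [hw, hj]
      · rw [dif_neg hj]
        rw [hpr_iff] at hj
        exact (hφsec j hj).symm
    have hw1 : star w ⬝ᵥ w = 1 := by
      have := star_blockExt_dotProduct pr w φ
      rw [hφext, hφ1] at this
      rw [this]
    have hray : (star φ ⬝ᵥ H *ᵥ φ).re = (star w ⬝ᵥ K *ᵥ w).re := by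
      rw [hKdef, star_dotProduct_toBlock_mulVec, hφext]
    rw [hray, hj₀, ← groundEnergy_eq_iInf_eigenvalues_holds hKherm]
    exact groundEnergy_le_rayleigh_holds hKherm w hw1
  -- entropy price: `64 ℓ / c + 1 ≤ ε L²`
  have hcardV : Real.log (Fintype.card {s // pr s}) ≤ 2 * (L : ℝ) ^ 2 * Real.log 2 := by
    have h1 : Fintype.card {s // pr s} ≤ Fintype.card (Finset (Orb (FermionTorus 2 L))) :=
      Fintype.card_subtype_le _
    have h2 : Fintype.card (Finset (Orb (FermionTorus 2 L))) = 2 ^ (2 * L ^ 2) := by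
      rw [Fintype.card_finset, card_orb, card_fermionTorus]
    have h3 : (Fintype.card {s // pr s} : ℝ) ≤ (2 : ℝ) ^ (2 * L ^ 2) := by
      rw [h2] at h1
      exact_mod_cast h1
    have h4 : (0 : ℝ) < Fintype.card {s // pr s} := by exact_mod_cast Fintype.card_pos
    calc Real.log (Fintype.card {s // pr s}) ≤ Real.log ((2 : ℝ) ^ (2 * L ^ 2)) := Real.log_le_log h4 h3
      _ = 2 * (L : ℝ) ^ 2 * Real.log 2 := by rw [Real.log_pow]; push_cast; ring
  have hlog2 : 0 < Real.log 2 := Real.log_pos one_lt_two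
  have hℓle : ℓ ≤ 2 * (L : ℝ) ^ 2 * Real.log 2 / (κ₀ * Real.log L) := by
    rw [hℓ, hβdef, div_le_div_iff₀ hβ (mul_pos hκ₀ hlogL)]
    exact mul_le_mul_of_nonneg_right hcardV (mul_pos hκ₀ hlogL).le
  have ht_le : t ≤ ε * (L : ℝ) ^ 2 := by
    -- `64 ℓ / c ≤ 128 L² log 2 / (c κ₀ log L) ≤ ε L² / 2` and `1 ≤ ε L² / 2`
    set Q : ℝ := 2 * (L : ℝ) ^ 2 * Real.log 2 / (κ₀ * Real.log L) with hQ
    have hκlog : 0 < κ₀ * Real.log L := mul_pos hκ₀ hlogL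
    have h1a : 64 * ℓ / c ≤ 64 * Q / c :=
      div_le_div_of_nonneg_right (mul_le_mul_of_nonneg_left hℓle (by norm_num)) hc.le
    have h1b : 64 * Q / c = 128 * (L : ℝ) ^ 2 * Real.log 2 / (c * (κ₀ * Real.log L)) := by
      rw [hQ]
      field_simp
      ring
    have hR' : 256 * Real.log 2 ≤ c * κ₀ * ε * Real.log L := by
      have := hlogR
      rw [hR, div_le_iff₀ (by positivity)] at this
      linarith
    have h1c : 128 * (L : ℝ) ^ 2 * Real.log 2 / (c * (κ₀ * Real.log L)) ≤ ε * (L : ℝ) ^ 2 / 2 := by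
      rw [div_le_iff₀ (mul_pos hc hκlog)]
      have hL2nn : (0 : ℝ) ≤ (L : ℝ) ^ 2 / 2 := by positivity
      have := mul_le_mul_of_nonneg_left hR' hL2nn
      have e1 : (L : ℝ) ^ 2 / 2 * (256 * Real.log 2) = 128 * (L : ℝ) ^ 2 * Real.log 2 := by ring
      have e2 : (L : ℝ) ^ 2 / 2 * (c * κ₀ * ε * Real.log L) = ε * (L : ℝ) ^ 2 / 2 * (c * (κ₀ * Real.log L)) := by
        ring
      rw [e1, e2] at this
      exact this
    have h2 : (1 : ℝ) ≤ ε * (L : ℝ) ^ 2 / 2 := by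
      rw [le_div_iff₀ (by norm_num : (0:ℝ) < 2)]
      have h2a : 2 ≤ ε * (L : ℝ) := by
        have := (div_le_iff₀ hε).mp hLε
        linarith
      nlinarith [h2a, hL1r, hε.le]
    rw [ht]
    linarith [h1a, h1b.le, h1b.ge, h1c, h2]
  -- the pair amplitude: `c L⁴ − 32 L⁴ ℓ / t ≥ (c/2) L⁴`
  have hamp : c / 2 * (L : ℝ) ^ 4 ≤ c * (L : ℝ) ^ 4 - 32 * (L : ℝ) ^ 4 * (Real.log (Fintype.card {s // pr s}) / β) / t := by
    rw [← hℓ]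
    have hkey : 32 * ℓ / t ≤ c / 2 := by
      rw [div_le_iff₀ ht0]
      have : c / 2 * t = 32 * ℓ + c / 2 := by
        rw [ht]
        field_simp
        ring
      rw [this]
      linarith
    have hL4 : (0 : ℝ) ≤ (L : ℝ) ^ 4 := by positivity
    have : 32 * (L : ℝ) ^ 4 * ℓ / t = (32 * ℓ / t) * (L : ℝ) ^ 4 := by ring
    rw [this]
    nlinarith [hkey, hL4]
  -- assemble the witness
  refine ⟨N, Or.inl rfl, v, hvmem, hv1, ?_, ?_⟩
  · rw [hvE]
    have hi := hlow j₀
    linarith [hfloor, ht_le]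
  · have hov : (star u ⬝ᵥ O *ᵥ u).re = (star (Δ *ᵥ v) ⬝ᵥ (Δ *ᵥ v)).re := hOform u
    rw [← hov]
    exact hamp.trans hobs

end Summit.HubbardSuperconductivity.HubbardSuperconductivity.Theorems.JosephsonMirror

end
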